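import Mathlib
import HarnessLib
import Summits.ValiantsHypothesis.ValiantsHypothesis.Statement
import Summits.ValiantsHypothesis.ValiantsHypothesis.Theses.GirthSidon
import Summits.ValiantsHypothesis.ValiantsHypothesis.Theorems.GirthSidonMomentCurveElusiveCoveringGirth
import Summits.ValiantsHypothesis.ValiantsHypothesis.Theorems.GirthSidonMomentCurveElusiveMonomialNumericToPuiseux

/-!
# Line-first skeleton — crux `SwallowForcesShortRelation` (item `stmt-ValiantsHypothesis-6535`,
route `GirthSidon`, rank 2: the load-bearing binder of the route's `closes`)

Line **SMALL SUMSET** (family-free): **TRANSFER → SMALL SUMSET COVER → GIRTH.**  The crux says: for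
large `m`, every exponent vector `d : Fin m → ℕ` and every `s` with `s^10 ≤ m^9`, if the monomial curve
`x ↦ (x^{d_i})_{i<m}` is NOT `(s,2)`-elusive over `ℂ` (Raz), then the exponents carry a short additive
relation — multisets `S ≠ T` over `Fin m` of size `≤ 30` with `Σ_S d = Σ_T d`.  This is the family-free
statement behind the target `MomentCurveElusive` (item `stmt-ValiantsHypothesis-6534`, whose registered
line `Cruxes/MomentCurveElusive/Lines/birth.lean` is this skeleton's parent: same three stubs, there
composed with the B₃₀ property of the power-sum code; here composed for an ARBITRARY `d`, so a repeated
exponent is disposed of by the trivial relation `{i} ≠ {j}` and no Vandermonde step occurs).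

* `stub_monomialNumericToPuiseux` (CLOSED by name — `Theorems/GirthSidonMomentCurveElusiveMonomialNumericToPuiseux.lean`,
  p147246; = route support `PuiseuxTransfer`, item 21118): a non-elusive monomial curve is swallowed
  FORMALLY after a ramification `x = t^N`: quadratic `Γ : ℂ^s → ℂ^m`, `y ∈ ℂ((t))^s`, `Γ_i(y) = t^{N d_i}`.
* `stub_swallowedInSmallSumset` (LOAD-BEARING, OPEN; verbatim the open stub of the parent line, so ONE
  proof closes both skeletons): a quadratic map on `s` sources, `s^10 ≤ m^9`, that formally swallows an
  INJECTIVE exponent vector `D : Fin m → ℕ` (`Γ_i(y) = t^{D_i}`) has its exponent SET inside a small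
  sumset `U + U`, `|U|^20 ≤ m^19`.  State of the art on this stub (lead cycles c1–c5 of the parent crux,
  `Cruxes/MomentCurveElusive/LEAD-ANALYSIS-c5.md`, `STRATEGY-CENSUS.md`): honest (non-cancelling)
  coordinates, toric and sparse swallowers are covered by `U = O ∪ {0}` (`O` = the `t`-orders of
  `span(1, y)`, `|O| ≤ s + 1`, echelon lemma `Theorems/GirthSidonMomentCurveElusiveEchelon.lean`); targets
  initiated by a NON-DEEP 2×2 cancellation are covered with `|U| ≤ n (log₂ n + 1)²`
  (`Theorems.exists_small_cover_of_twoByTwo`, `…TwoByTwoCover.lean`, with `…NonResonantCover`,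
  `…ResonantCover`, `…DepthDichotomy`, `…BornBudget`); the named RESIDUAL is the class of DEEP /
  LINEAR-DEPTH resonances (`γ ≠ g₁ + g₂`: depth equal to the order of `u_a + u_b − u_c − u_d`, levels of
  the echelon flag) and cancellations not initiated by a 2×2 gadget.  Why it might fail: dense
  high-degree pools with `≫ m^{0.05}·s` spread-out 2×2-determinant relations would swallow a set of large
  cover number (no such family is on record; GMOW 2019 §9, Narayanan 2026 §1.7; route why-might-fail:
  leading-term cancellation at both places in all but `m^{0.93}` coordinates).  [difficulty: open-problem]
* `stub_coveringGirth` (CLOSED by name — `Theorems/GirthSidonMomentCurveElusiveCoveringGirth.lean`,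
  p146081): an injective `D ⊆ U + U` with `|U|^20 ≤ m^19`, `m ≥ m₀`, has a short alternating relation
  (covering graph on `U`, dense core + Moore bound, `k = 30`).

The composition `SwallowForcesShortRelation_of` is proved here (sorry-free): for `m ≥ max m₁ m₂`,
`s^10 ≤ m^9` and a non-elusive monomial curve, either `d` repeats a value (`S = {i}`, `T = {j}`), or `d`
is injective, the transfer stub gives a formal swallowing of `D = N • d` (injective as `N ≥ 1`), the cover
stub gives `U`, the girth stub gives `S ≠ T` with `Σ_S N d = Σ_T N d`, and `N` cancels.  The conclusion
is the route decl `GirthSidon.SwallowForcesShortRelation` BY NAME; `SwallowForcesShortRelation_proof`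
applies it to the three stubs (the only `sorry` of the file is inside `stub_swallowedInSmallSumset`).

Relation to the route's other items: `SwallowOfFormal` (item 21121, PROVED) + `PuiseuxTransfer` (item
21118, PROVED) already register `FormalSwallowForcesShortRelation` (item 6536, open) as a typed
sufficient line for this crux; the present line factors that formal statement further through the
additive-cover statement, which is STRONGER than item 6536 exactly by `stub_coveringGirth` and is the
statement the parent crux's lead programme actually attacks.  Disproof used: none on file
(`ledger crux ls stmt-ValiantsHypothesis-6535`: no workfiles; negatives index: only the toric
`s = m − 1` Sidon refutation `ElusiveElusiveCandidate_refuted`, outside `s^10 ≤ m^9` and an INSTANCE of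
the cover statement with `U = O ∪ {0}`).  VP ≠ VNP is not proved by anything here; the line closes no
item by itself.
-/

set_option linter.dupNamespace false

namespace Summit.ValiantsHypothesis.ValiantsHypothesis.Cruxes.SwallowForcesShortRelation.SmallSumset

open Summit.ValiantsHypothesis.ValiantsHypothesis.Theses.GirthSidon

/-! ## §1 The stub statements as named propositions -/

namespace Sig

/-- **Stub 1** (numeric-to-Puiseux transfer for monomial curves). -/
def stub_monomialNumericToPuiseux : Prop :=
    ∀ (m s : ℕ) (d : Fin m → ℕ),
      ¬ Literature.Computability.AlgebraicComplexity.IsElusive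
          (fun i : Fin m => (MvPolynomial.X 0 : MvPolynomial (Fin 1) ℂ) ^ d i) s 2 →
      ∃ (N : ℕ) (Γ : Fin m → MvPolynomial (Fin s) ℂ) (y : Fin s → LaurentSeries ℂ),
        0 < N ∧ (∀ i, (Γ i).totalDegree ≤ 2) ∧
          ∀ i, MvPolynomial.aeval y (Γ i) = HahnSeries.single ((N * d i : ℕ) : ℤ) (1 : ℂ)

/-- **Stub 2** (formally swallowed injective exponent sets lie in a small sumset; load-bearing). -/
def stub_swallowedInSmallSumset : Prop :=
    ∃ m₀ : ℕ, ∀ m ≥ m₀, ∀ (D : Fin m → ℕ) (s : ℕ), s ^ 10 ≤ m ^ 9 → Function.Injective D →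
      ∀ (Γ : Fin m → MvPolynomial (Fin s) ℂ) (y : Fin s → LaurentSeries ℂ),
        (∀ i, (Γ i).totalDegree ≤ 2) →
        (∀ i, MvPolynomial.aeval y (Γ i) = HahnSeries.single (D i : ℤ) (1 : ℂ)) →
        ∃ U : Finset ℤ, U.card ^ 20 ≤ m ^ 19 ∧ ∀ i, ∃ a ∈ U, ∃ b ∈ U, (D i : ℤ) = a + b

/-- **Stub 3** (covering girth). -/
def stub_coveringGirth : Prop :=
    ∃ m₀ : ℕ, ∀ m ≥ m₀, ∀ (D : Fin m → ℕ), Function.Injective D →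
      ∀ U : Finset ℤ, U.card ^ 20 ≤ m ^ 19 →
        (∀ i, ∃ a ∈ U, ∃ b ∈ U, (D i : ℤ) = a + b) →
        ∃ S T : Multiset (Fin m), S ≠ T ∧ Multiset.card S ≤ 30 ∧ Multiset.card T ≤ 30 ∧
          (S.map D).sum = (T.map D).sum

end Sig

/-! ## §2 The three registered stubs (`sorry` lives only in `stub_swallowedInSmallSumset`) -/

/-- **Stub 1 (numeric-to-Puiseux transfer for monomial curves; CLOSED by name).** If the monomial
curve `x ↦ (x^{d_i})_{i<m}` is not `(s,2)`-elusive over `ℂ`, then for some `N ≥ 1`, some quadratic `Γ`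
and Laurent series `y ∈ ℂ((t))^s`, `Γ_i(y) = t^{N d_i}` for every `i`.  GMOW 2019 Lemma 9.3
(`Literature.Computability.AlgebraicComplexity.exists_aeval_eq_X_pow_of_not_isElusive`) + Newton–Puiseux
(`Summit.ValiantsHypothesis.Theorems.exists_laurent_relation_transfer`); landed as
`Theorems.stub_monomialNumericToPuiseux`. [difficulty: closed] -/
theorem stub_monomialNumericToPuiseux :
    ∀ (m s : ℕ) (d : Fin m → ℕ),
      ¬ Literature.Computability.AlgebraicComplexity.IsElusive
          (fun i : Fin m => (MvPolynomial.X 0 : MvPolynomial (Fin 1) ℂ) ^ d i) s 2 →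
      ∃ (N : ℕ) (Γ : Fin m → MvPolynomial (Fin s) ℂ) (y : Fin s → LaurentSeries ℂ),
        0 < N ∧ (∀ i, (Γ i).totalDegree ≤ 2) ∧
          ∀ i, MvPolynomial.aeval y (Γ i) = HahnSeries.single ((N * d i : ℕ) : ℤ) (1 : ℂ) :=
  Summit.ValiantsHypothesis.ValiantsHypothesis.Theorems.stub_monomialNumericToPuiseux

/-- **Stub 2 (swallowed injective exponent sets lie in a small sumset; LOAD-BEARING, open).** For
`m ≥ m₀`, `s^10 ≤ m^9`, an injective `D : Fin m → ℕ`, a quadratic `Γ : ℂ^s → ℂ^m` and `y ∈ ℂ((t))^s`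
with `Γ_i(y) = t^{D_i}` for all `i`: there is `U ⊂ ℤ` with `|U|^20 ≤ m^19` and `D ⊆ U + U`.
Verbatim the open stub of `Cruxes/MomentCurveElusive/Lines/birth.lean` (one proof closes both lines).
Why plausibly true: honest coordinates give `D_i ∈ (O ∪ {0}) + (O ∪ {0})`, `O` = `t`-orders of
`span(1, y)`, `|O| ≤ s + 1 ≤ m^{0.9} + 1`; non-deep 2×2-initiated cancellations cost a factor
`(log₂ n + 1)²` only (`Theorems.exists_small_cover_of_twoByTwo`); every swallower on record is covered.
Why it might fail: deep / linear-depth resonant cancellations in `≫ m^{0.95}` coordinates (none on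
record).  [difficulty: open-problem] -/
theorem stub_swallowedInSmallSumset :
    ∃ m₀ : ℕ, ∀ m ≥ m₀, ∀ (D : Fin m → ℕ) (s : ℕ), s ^ 10 ≤ m ^ 9 → Function.Injective D →
      ∀ (Γ : Fin m → MvPolynomial (Fin s) ℂ) (y : Fin s → LaurentSeries ℂ),
        (∀ i, (Γ i).totalDegree ≤ 2) →
        (∀ i, MvPolynomial.aeval y (Γ i) = HahnSeries.single (D i : ℤ) (1 : ℂ)) →
        ∃ U : Finset ℤ, U.card ^ 20 ≤ m ^ 19 ∧ ∀ i, ∃ a ∈ U, ∃ b ∈ U, (D i : ℤ) = a + b := by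
  sorry

/-- **Stub 3 (covering girth; CLOSED by name).** For `m ≥ m₀`, an injective `D : Fin m → ℕ`
contained in `U + U` with `|U|^20 ≤ m^19` admits multisets `S ≠ T` of indices, each of size `≤ 30`,
with `Σ_S D = Σ_T D` (covering graph, dense core + Moore count, `k = 30`); landed as
`Theorems.stub_coveringGirth`. [difficulty: closed] -/
theorem stub_coveringGirth :
    ∃ m₀ : ℕ, ∀ m ≥ m₀, ∀ (D : Fin m → ℕ), Function.Injective D →
      ∀ U : Finset ℤ, U.card ^ 20 ≤ m ^ 19 →
        (∀ i, ∃ a ∈ U, ∃ b ∈ U, (D i : ℤ) = a + b) →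
        ∃ S T : Multiset (Fin m), S ≠ T ∧ Multiset.card S ≤ 30 ∧ Multiset.card T ≤ 30 ∧
          (S.map D).sum = (T.map D).sum :=
  Summit.ValiantsHypothesis.ValiantsHypothesis.Theorems.stub_coveringGirth

/-! ## §3 Proved glue: a repeated exponent is a short relation -/

/-- If `d` is not injective, `{i} ≠ {j}` with `d i = d j` is a relation of sizes `1, 1`. [folklore] -/
theorem relation_of_not_injective {m : ℕ} (d : Fin m → ℕ) (h : ¬ Function.Injective d) :
    ∃ S T : Multiset (Fin m), S ≠ T ∧ Multiset.card S ≤ 30 ∧ Multiset.card T ≤ 30 ∧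
      (S.map d).sum = (T.map d).sum := by
  obtain ⟨i, j, hij, hne⟩ := Function.not_injective_iff.mp h
  refine ⟨{i}, {j}, ?_, by simp, by simp, by simp [hij]⟩
  intro hST
  exact hne (Multiset.singleton_inj.mp hST)

/-! ## §4 The kernel-checked composition -/

/-- **Assembly of the line.** `stub_monomialNumericToPuiseux → stub_swallowedInSmallSumset →
stub_coveringGirth → SwallowForcesShortRelation`: for `m ≥ max m₁ m₂`, `s^10 ≤ m^9` and a non-elusive
monomial curve with exponents `d`, either `d` repeats a value (trivial relation), or `d` is injective:
transfer to a formal swallowing of `D = N • d` (injective), cover by `U`, girth gives `S ≠ T` with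
`Σ_S N d = Σ_T N d`, cancel `N ≥ 1`.  The conclusion is the route decl
`GirthSidon.SwallowForcesShortRelation` BY NAME. -/
theorem SwallowForcesShortRelation_of :
    Sig.stub_monomialNumericToPuiseux → Sig.stub_swallowedInSmallSumset → Sig.stub_coveringGirth →
      Summit.ValiantsHypothesis.ValiantsHypothesis.Theses.GirthSidon.SwallowForcesShortRelation := by
  rintro hT ⟨m₁, hm₁⟩ ⟨m₂, hm₂⟩
  refine ⟨max m₁ m₂, fun m hm d s hs hne => ?_⟩
  have hm1 : m₁ ≤ m := le_trans (le_max_left _ _) hm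
  have hm2 : m₂ ≤ m := le_trans (le_max_right _ _) hm
  by_cases hinj : Function.Injective d
  · -- Stub 1: a formal swallowing of `t^{N d_i}`
    obtain ⟨N, Γ, y, hN, hΓ, hy⟩ := hT m s d hne
    -- the scaled exponent vector is injective
    have hDinj : Function.Injective (fun i : Fin m => N * d i) :=
      fun i j (hij : N * d i = N * d j) => hinj (Nat.eq_of_mul_eq_mul_left hN hij)
    -- Stub 2: a small sumset cover
    obtain ⟨U, hU, hcov⟩ := hm₁ m hm1 (fun i : Fin m => N * d i) s hs hDinj Γ y hΓ hy
    -- Stub 3: a short alternating relation among the scaled exponents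
    obtain ⟨S, T, hST, hS, hT30, hsum⟩ := hm₂ m hm2 (fun i : Fin m => N * d i) hDinj U hU hcov
    refine ⟨S, T, hST, hS, hT30, ?_⟩
    -- cancel `N`
    rw [Multiset.sum_map_mul_left, Multiset.sum_map_mul_left] at hsum
    exact Nat.eq_of_mul_eq_mul_left hN hsum
  · exact relation_of_not_injective d hinj

/-- **The skeleton**: `GirthSidon.SwallowForcesShortRelation` BY NAME, modulo exactly the three
registered stubs (`sorry` occurs only inside `stub_swallowedInSmallSumset`). -/
theorem SwallowForcesShortRelation_proof :
    Summit.ValiantsHypothesis.ValiantsHypothesis.Theses.GirthSidon.SwallowForcesShortRelation :=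
  SwallowForcesShortRelation_of stub_monomialNumericToPuiseux stub_swallowedInSmallSumset
    stub_coveringGirth

end Summit.ValiantsHypothesis.ValiantsHypothesis.Cruxes.SwallowForcesShortRelation.SmallSumset
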